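import Summits.CriticalPhenomena.PercolationContinuityZ3.Theorems.SahiMasterFamilyPhiVertex
import Literature.Combinatorics.Sahi2008.GeneratingFunction

/-!
# Hereditary Sahi positivity of a set function survives scaling `β ↦ v·β` (`0 ≤ v ≤ 1`), every order;
# honest sub-functionals on the rays through the vertices, and `F(n)` on the chains `1_{𝒰∋i₀} + v·1_{𝒰∌i₀}`

Unit `prim-masterthm-p4` (gen 14; crux anchor stmt-CriticalPhenomena-4575, helper work; memo
`run/shared/lean/prim/prim-masterthm/prim-masterthm-p4/P4-GEN14-REPORT.md` §3).  Companion of `…PhiVertex` ((V): `F(n)` at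
vertices) and `…PrincipalCapBeta` (`phiSet`, `PhiNonneg`).

**THEOREM (every order)** `phiSet_smul_nonneg_of_subfamilies`.  Let `β : Finset (Fin (n+1)) → ℝ` be HEREDITARILY Sahi-nonnegative:
`Φ_{k+1}(S ↦ β(e S)) ≥ 0` for every embedding `e : Fin (k+1) ↪ Fin (n+1)` (every honest sub-functional, the top one included).
Then for every `v ∈ [0,1]`, `Φ_{n+1}(v·β) ≥ 0` — and `v·β` is again hereditarily nonnegative (`…_map`).  In particular
(`phiSet_smul_indicator_nonneg`) **every honest sub-functional on the ray `v·1_𝒰` through a vertex is `≥ 0`** (𝒰 union-closed,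
no top condition), and (`phiSet_chain_singleton_nonneg`) **`F(n+1)` holds at the two-level chain points
`β = 1 on {S ∈ 𝒰 : i₀ ∈ S}`, `= v on {S ∈ 𝒰 : i₀ ∉ S}`, `= 0 off 𝒰`** for every union-closed `𝒰 ∋ univ`, every `i₀`, every
`v ∈ [0,1]` — an explicit infinite family of non-vertex points of the feasible set of `PhiNonneg (n+1)`, every order.

PROOF (Sahi's generating function, [Sahi2008, Prop. 12 / eq. (14)], in the tree's square-free algebra `SqFree`).
In the canonical signed model (`realW`, `realF` of `…PrincipalCapBetaSmall`; the set function is normalised to `1` at `∅` so that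
the weight has mass one) Proposition 12 at every monomial (`coeff_one_sub_prod_binomB_lin`) says that
`Z := ∏_S (1 − Σ_{i∈S} t_i)^{realW β (S)}` has `[t^T](1 − Z) = Φ_T(β|_T) ≥ 0`, i.e. `1 − Z ∈ 𝒫`.  The weight
`v·realW β + (1−v)·δ_∅` has mass one and moments `v·β_T` (`T ≠ ∅`), so `Φ_{n+1}(vβ) = [t^univ](1 − ∏_S (1−u_S)^{v·realW β(S)})`
(`sahiE_eq_gfE`), and by the exponent laws of `binomB` (`(1−u)^{vs} = (1 − (1 − (1−u)^s))^v`,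
`(1−a)^v(1−b)^v = (1 − (a+b−ab))^v`) the product is `(1 − (1 − Z))^v`; finally `1 − (1−Γ)^v ∈ 𝒫` for `Γ ∈ 𝒫`, `0 ≤ v ≤ 1`
is [Sahi2008, proof of Lemma 16] (`one_sub_binomB_of_unit`).  Equivalently
`Φ_T(vβ) = Σ_{π ⊢ T} v(1−v)(2−v)⋯(|π|−1−v)·∏_{B∈π} Φ_B(β|_B)`.
HONEST FRAMING: structural; `PhiNonneg n` for `n ≥ 8`, Sahi's `C_k`, Kahn's Conjecture 5 and the master theorem remain OPEN.
Axioms standard. [this work]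
-/

noncomputable section

open scoped Classical

open private binomB_mul_binomB binomB_one_sub_binomB binomB_zero_right isNil_one_sub_binomB coeff_empty_binomB
  isNil_lin coeff_sub coeff_one coeff_mul coeff_sum coeff_single IsNil.add IsNil.mul_left
  from Literature.Combinatorics.Sahi2008.CumulationCone

namespace Summit.CriticalPhenomena.PercolationContinuityZ3.Theorems

namespace PhiScale

open Finset Function
open Literature.Combinatorics.Sahi2008
open Literature.Combinatorics.Sahi2008.SqFree (binomB lin IsNil Nonneg single)
open PrincipalCapBeta (phiSet realF realW)

variable {n : ℕ}

/-! ### `Φ` only sees nonempty sets; the normalised set function and the mixed weight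

Throughout, `fun S => if S = ∅ then 1 else β S` is `β` normalised to `1` at `∅` (so that `realW` has mass one), and
`fun S => v * realW (…) S + (1 - v) * (if S = ∅ then 1 else 0)` is the mixed weight `v·realW + (1−v)·δ_∅`. -/

/-- Blocks of a set partition are nonempty. [folklore] -/
theorem block_nonempty (c : OrderedFinpartition n) (j : Fin c.length) : (PartitionForm.block c j).Nonempty := by
  rw [← Finset.card_pos, PartitionForm.card_block]; exact c.partSize_pos j

/-- `Φ_n(m)` depends only on the values of `m` on nonempty sets. [this work] -/
theorem phiSet_congr {m m' : Finset (Fin n) → ℝ} (h : ∀ B, B.Nonempty → m B = m' B) : phiSet n m = phiSet n m' := by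
  unfold PrincipalCapBeta.phiSet
  refine sum_congr rfl fun c _ => ?_
  congr 1
  exact prod_congr rfl fun j _ => by rw [h _ (block_nonempty c j)]

/-- `Σ_S realW β₁ S = 1` for the set function `β₁` normalised to `1` at `∅`. [this work] -/
theorem sum_realW_norm1 (β : Finset (Fin n) → ℝ) :
    ∑ S, realW (fun S : Finset (Fin n) => if S = ∅ then (1 : ℝ) else β S) S = 1 := by
  have h := PrincipalCapBeta.ex_realW_prod (fun S : Finset (Fin n) => if S = ∅ then (1 : ℝ) else β S) ∅
  rw [prod_empty, ex_def] at h
  simp only [Pi.one_apply, mul_one] at h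
  rw [h]; simp

/-- `realF i ∅ = 0`: no coordinate indicator fires at the empty configuration. [this work] -/
theorem realF_empty (i : Fin n) : realF i (∅ : Finset (Fin n)) = 0 := by
  unfold PrincipalCapBeta.realF; simp

/-- A product of coordinate indicators over a nonempty index set vanishes at `∅`. [this work] -/
theorem prod_realF_empty {B : Finset (Fin n)} (hB : B.Nonempty) : (∏ i ∈ B, realF i) (∅ : Finset (Fin n)) = 0 := by
  rw [Finset.prod_apply]
  obtain ⟨i, hi⟩ := hB
  exact prod_eq_zero hi (realF_empty i)

/-- The mixed weight has mass one. [this work] -/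
theorem sum_mixW (β : Finset (Fin n) → ℝ) (v : ℝ) :
    ∑ S, (v * realW (fun S : Finset (Fin n) => if S = ∅ then (1 : ℝ) else β S) S +
      (1 - v) * (if S = ∅ then (1 : ℝ) else 0)) = 1 := by
  rw [sum_add_distrib, ← mul_sum, ← mul_sum, sum_realW_norm1, sum_ite_eq']
  simp

/-- Moments of the mixed weight: `E(∏_{i∈B} realF i) = v·β B` for nonempty `B`. [this work] -/
theorem ex_mixW_prod (β : Finset (Fin n) → ℝ) (v : ℝ) {B : Finset (Fin n)} (hB : B.Nonempty) :
    ex (fun S : Finset (Fin n) => v * realW (fun S : Finset (Fin n) => if S = ∅ then (1 : ℝ) else β S) S +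
        (1 - v) * (if S = ∅ then (1 : ℝ) else 0)) (∏ i ∈ B, realF i) = v * β B := by
  have h1 := PrincipalCapBeta.ex_realW_prod (fun S : Finset (Fin n) => if S = ∅ then (1 : ℝ) else β S) B
  rw [ex_def] at h1 ⊢
  simp only [add_mul, sum_add_distrib]
  have e1 : ∑ S, v * realW (fun S : Finset (Fin n) => if S = ∅ then (1 : ℝ) else β S) S * (∏ i ∈ B, realF i) S =
      v * ∑ S, realW (fun S : Finset (Fin n) => if S = ∅ then (1 : ℝ) else β S) S * (∏ i ∈ B, realF i) S := by
    rw [mul_sum]; exact sum_congr rfl fun S _ => by ring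
  have e2 : ∑ S : Finset (Fin n), (1 - v) * (if S = ∅ then (1 : ℝ) else 0) * (∏ i ∈ B, realF i) S = 0 := by
    refine sum_eq_zero fun S _ => ?_
    by_cases hS : S = ∅
    · rw [hS, prod_realF_empty hB, mul_zero]
    · rw [if_neg hS, mul_zero, zero_mul]
  rw [e1, e2, h1, if_neg hB.ne_empty, add_zero]

/-! ### Square-free bookkeeping -/

section Sq

variable {κ : Type*} [DecidableEq κ] [Fintype κ]

omit [DecidableEq κ] [Fintype κ] in
/-- Structure eta for `SqFree`. [folklore] -/
theorem sqFree_ext {a b : SqFree κ ℝ} (h : ∀ τ, a.coeff τ = b.coeff τ) : a = b := by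
  cases a; cases b; congr; funext τ; exact h τ

omit [Fintype κ] in
/-- `(1 − x) + (1 − y) − (1 − x)(1 − y) = 1 − x·y`. [folklore] -/
theorem one_sub_add (x y : SqFree κ ℝ) : (1 - x) + (1 - y) - (1 - x) * (1 - y) = 1 - x * y := by ring

omit [Fintype κ] in
/-- If `x` and `y` have constant term `1` (`1 − x`, `1 − y` nil) then so does `x·y`. [folklore] -/
theorem isNil_one_sub_mul {x y : SqFree κ ℝ} (hx : (1 - x).IsNil) (hy : (1 - y).IsNil) : (1 - x * y).IsNil := by
  have e : (1 : SqFree κ ℝ) - x * y = (1 - x) + x * (1 - y) := by ring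
  rw [e]
  have h2 : (x * (1 - y)).IsNil := by rw [mul_comm]; exact IsNil.mul_left hy x
  exact IsNil.add hx h2

omit [Fintype κ] in
/-- Products of elements with constant term `1` have constant term `1`. [folklore] -/
theorem isNil_one_sub_prod {ι' : Type*} (s : Finset ι') (x : ι' → SqFree κ ℝ) (hx : ∀ a ∈ s, (1 - x a).IsNil) :
    (1 - ∏ a ∈ s, x a).IsNil := by
  induction s using Finset.induction_on with
  | empty => rw [prod_empty, sub_self]; rfl
  | insert a s ha ih =>
    rw [prod_insert ha]
    exact isNil_one_sub_mul (hx a (mem_insert_self a s)) (ih fun b hb => hx b (mem_insert_of_mem hb))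

/-- **Power of a product**: `∏_{a∈s} (1 − (1 − x_a))^v = (1 − (1 − ∏_a x_a))^v` for `x_a` with constant term `1`, i.e.
`∏ x_a^v = (∏ x_a)^v` in the square-free algebra. [folklore] -/
theorem prod_binomB_one_sub {ι' : Type*} (s : Finset ι') (x : ι' → SqFree κ ℝ) (hx : ∀ a ∈ s, (1 - x a).IsNil) (v : ℝ) :
    ∏ a ∈ s, binomB v (1 - x a) = binomB v (1 - ∏ a ∈ s, x a) := by
  induction s using Finset.induction_on with
  | empty => rw [prod_empty, prod_empty, sub_self, binomB_zero_right]
  | insert a s ha ih =>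
    have hxa : (1 - x a).IsNil := hx a (mem_insert_self a s)
    have hs : ∀ b ∈ s, (1 - x b).IsNil := fun b hb => hx b (mem_insert_of_mem hb)
    rw [prod_insert ha, prod_insert ha, ih hs, binomB_mul_binomB hxa (isNil_one_sub_prod s x hs) v, one_sub_add]

end Sq

/-! ### The generating function of the scaled set function -/

/-- The linear form `Σ_i t_i·realF_i(∅)` vanishes. [this work] -/
theorem lin_realF_empty : lin (realF (n := n)) (∅ : Finset (Fin n)) = 0 := by
  refine sqFree_ext fun τ => ?_
  unfold SqFree.lin
  rw [coeff_sum]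
  refine (sum_eq_zero fun i _ => ?_).trans rfl
  rw [coeff_single, realF_empty]; split_ifs <;> rfl

/-- **The product for the mixed weight is the `v`-th power of `Z := ∏_S (1 − Σ_{i∈S} t_i)^{realW β₁(S)}`**:
`∏_S (1−u_S)^{(v·realW β₁ + (1−v)δ_∅)(S)} = (1 − (1 − Z))^v`. [this work] -/
theorem prod_binomB_mixW (β : Finset (Fin n) → ℝ) (v : ℝ) :
    ∏ S, binomB (v * realW (fun S : Finset (Fin n) => if S = ∅ then (1 : ℝ) else β S) S +
        (1 - v) * (if S = ∅ then (1 : ℝ) else 0)) (lin realF S) =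
      binomB v (1 - ∏ S, binomB (realW (fun S : Finset (Fin n) => if S = ∅ then (1 : ℝ) else β S) S) (lin realF S)) := by
  rw [← prod_binomB_one_sub univ
    (fun S => binomB (realW (fun S : Finset (Fin n) => if S = ∅ then (1 : ℝ) else β S) S) (lin realF S))
    (fun S _ => isNil_one_sub_binomB (isNil_lin realF S) _) v]
  refine prod_congr rfl fun S _ => ?_
  by_cases hS : S = ∅
  · subst hS
    rw [lin_realF_empty, binomB_zero_right, binomB_zero_right, sub_self, binomB_zero_right]
  · rw [if_neg hS, mul_zero, add_zero,
      binomB_one_sub_binomB (isNil_lin realF S) v (realW (fun S : Finset (Fin n) => if S = ∅ then (1 : ℝ) else β S) S)]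

/-! ### Honest sub-functionals as coefficients of `1 − Z` -/

/-- Transport of `sahiE` along an equality of arities. [folklore] -/
theorem sahiE_cast {α : Type*} [Fintype α] (μ : α → ℝ) {m m' : ℕ} (h : m = m') (f : Fin m' → α → ℝ) :
    sahiE μ m (fun i => f (Fin.cast h i)) = sahiE μ m' f := by
  subst h; rfl

/-- **The coefficient of `t^τ` in `1 − Z` is the honest sub-functional on `τ`**: for nonempty `τ` there is an enumeration
`e : Fin (k+1) ↪ Fin n` of `τ` with `[t^τ](1 − Z) = Φ_{k+1}(S ↦ β(e S))`. [this work] -/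
theorem coeff_one_sub_zProd (β : Finset (Fin n) → ℝ) {τ : Finset (Fin n)} (hτ : τ.Nonempty) :
    ∃ (k : ℕ) (e : Fin (k + 1) ↪ Fin n),
      (1 - ∏ S, binomB (realW (fun S : Finset (Fin n) => if S = ∅ then (1 : ℝ) else β S) S) (lin realF S)).coeff τ =
        phiSet (k + 1) (fun S => β (S.map e)) := by
  obtain ⟨k, hk⟩ := Nat.exists_eq_succ_of_ne_zero (card_ne_zero.2 hτ)
  -- enumeration of `τ` by `Fin (k+1)`
  let e : Fin (k + 1) ↪ Fin n :=
    ⟨fun j => ((τ.equivFin.symm (Fin.cast hk.symm j) : τ) : Fin n), fun j j' h => by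
      have h1 := Subtype.ext h
      have h2 := τ.equivFin.symm.injective h1
      exact Fin.cast_injective _ h2⟩
  refine ⟨k, e, ?_⟩
  have hco : (1 - ∏ S, binomB (realW (fun S : Finset (Fin n) => if S = ∅ then (1 : ℝ) else β S) S) (lin realF S)).coeff τ =
      sahiEOn (realW (fun S : Finset (Fin n) => if S = ∅ then (1 : ℝ) else β S)) τ realF := by
    unfold SqFree.lin
    exact coeff_one_sub_prod_binomB_lin _ (sum_realW_norm1 β) realF τ
  rw [hco, sahiEOn]
  -- reindex the arity `τ.card = k+1`
  have hF : (fun i : Fin τ.card => (fun j : Fin (k + 1) => realF (e j)) (Fin.cast hk i)) =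
      fun i => realF ((τ.equivFin.symm i : τ) : Fin n) := by
    funext i
    have hc : Fin.cast hk.symm (Fin.cast hk i) = i := Fin.ext (by simp)
    show realF ((τ.equivFin.symm (Fin.cast hk.symm (Fin.cast hk i)) : τ) : Fin n) = realF ((τ.equivFin.symm i : τ) : Fin n)
    rw [hc]
  have hre : sahiE (realW (fun S : Finset (Fin n) => if S = ∅ then (1 : ℝ) else β S)) τ.card
        (fun i => realF ((τ.equivFin.symm i : τ) : Fin n)) =
      sahiE (realW (fun S : Finset (Fin n) => if S = ∅ then (1 : ℝ) else β S)) (k + 1) (fun j => realF (e j)) := by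
    rw [← sahiE_cast _ hk (fun j => realF (e j)), hF]
  rw [hre, PrincipalCapBeta.sahiE_eq_phiSet]
  refine phiSet_congr fun B hB => ?_
  show ex (realW (fun S : Finset (Fin n) => if S = ∅ then (1 : ℝ) else β S)) (∏ x ∈ B, realF (e x)) = β (B.map e)
  rw [← Finset.prod_map B e realF, PrincipalCapBeta.ex_realW_prod]
  exact if_neg (hB.map).ne_empty

/-- `1 − Z ∈ 𝒫` when `β` is hereditarily Sahi-nonnegative. [this work] -/
theorem one_sub_zProd_nonneg (β : Finset (Fin n) → ℝ)
    (hher : ∀ (k : ℕ) (e : Fin (k + 1) ↪ Fin n), 0 ≤ phiSet (k + 1) (fun S => β (S.map e))) :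
    (1 - ∏ S, binomB (realW (fun S : Finset (Fin n) => if S = ∅ then (1 : ℝ) else β S) S) (lin realF S)).Nonneg := by
  intro τ
  by_cases hτ : τ = ∅
  · subst hτ
    have h : (1 - ∏ S, binomB (realW (fun S : Finset (Fin n) => if S = ∅ then (1 : ℝ) else β S) S) (lin realF S)).IsNil :=
      isNil_one_sub_prod univ _ (fun S _ => isNil_one_sub_binomB (isNil_lin realF S) _)
    exact le_of_eq h.symm
  · obtain ⟨k, e, he⟩ := coeff_one_sub_zProd β (nonempty_iff_ne_empty.2 hτ)
    rw [he]; exact hher k e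

/-! ### The theorem -/

/-- **Scaling preserves hereditary Sahi positivity (every order).**  If every honest sub-functional of `β` (along every
embedding `Fin (k+1) ↪ Fin (n+1)`, the identity included) is `≥ 0`, then `Φ_{n+1}(v·β) ≥ 0` for every `v ∈ [0,1]`. [this work] -/
theorem phiSet_smul_nonneg_of_subfamilies (β : Finset (Fin (n + 1)) → ℝ)
    (hher : ∀ (k : ℕ) (e : Fin (k + 1) ↪ Fin (n + 1)), 0 ≤ phiSet (k + 1) (fun S => β (S.map e)))
    {v : ℝ} (hv0 : 0 ≤ v) (hv1 : v ≤ 1) :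
    0 ≤ phiSet (n + 1) (fun S => v * β S) := by
  -- `Φ(vβ)` is the Sahi functional of the mixed weight
  have h1 : phiSet (n + 1) (fun S => v * β S) =
      sahiE (fun S : Finset (Fin (n + 1)) => v * realW (fun S : Finset (Fin (n + 1)) => if S = ∅ then (1 : ℝ) else β S) S +
        (1 - v) * (if S = ∅ then (1 : ℝ) else 0)) (n + 1) realF := by
    rw [PrincipalCapBeta.sahiE_eq_phiSet]
    exact phiSet_congr fun B hB => (ex_mixW_prod β v hB).symm
  rw [h1, sahiE_eq_gfE _ (sum_mixW β v) (n + 1) realF]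
  unfold gfE
  rw [prod_binomB_mixW]
  exact SqFree.Nonneg.one_sub_binomB_of_unit hv0 hv1 (one_sub_zProd_nonneg β hher) univ

/-- Restrictions commute with scaling, so `v·β` is again HEREDITARILY nonnegative. [this work] -/
theorem phiSet_smul_nonneg_of_subfamilies_map (β : Finset (Fin (n + 1)) → ℝ)
    (hher : ∀ (k : ℕ) (e : Fin (k + 1) ↪ Fin (n + 1)), 0 ≤ phiSet (k + 1) (fun S => β (S.map e)))
    {v : ℝ} (hv0 : 0 ≤ v) (hv1 : v ≤ 1) (k : ℕ) (e : Fin (k + 1) ↪ Fin (n + 1)) :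
    0 ≤ phiSet (k + 1) (fun S => v * β (S.map e)) :=
  phiSet_smul_nonneg_of_subfamilies (fun S => β (S.map e))
    (fun k' e' => by
      have h := hher k' (e'.trans e)
      have hfun : (fun S : Finset (Fin (k' + 1)) => β (S.map (e'.trans e))) = fun S => β ((S.map e').map e) := by
        funext S; rw [Finset.map_map]
      rwa [hfun] at h)
    hv0 hv1

/-! ### Vertex rays and the two-level chains through `i₀` -/

/-- **Vertices are hereditarily honest (no top condition)**: a `0/1`-valued supermultiplicative set function has all its
honest sub-functionals `≥ 0`. [this work] -/
theorem phiSet_map_nonneg_of_zero_one (β : Finset (Fin n) → ℝ) (h01 : ∀ B, β B = 0 ∨ β B = 1)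
    (hsup : ∀ S T, β S * β T ≤ β (S ∪ T)) (k : ℕ) (e : Fin (k + 1) ↪ Fin n) :
    0 ≤ phiSet (k + 1) (fun S => β (S.map e)) := by
  have h01' : ∀ B : Finset (Fin (k + 1)), β (B.map e) = 0 ∨ β (B.map e) = 1 := fun B => h01 _
  have h0' : ∀ B : Finset (Fin (k + 1)), 0 ≤ β (B.map e) := fun B => by rcases h01 (B.map e) with h | h <;> simp [h]
  have hsup' : ∀ S T : Finset (Fin (k + 1)), β (S.map e) * β (T.map e) ≤ β ((S ∪ T).map e) := fun S T => by
    rw [Finset.map_union]; exact hsup _ _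
  rcases h01' univ with hz | ho
  · exact le_of_eq (PhiVertex.phiSet_eq_zero_of_univ_eq_zero (fun S => β (S.map e)) h0' hsup' hz).symm
  · exact PhiVertex.phiSet_nonneg_of_zero_one k (fun S => β (S.map e)) h01' ho hsup'

/-- **Honest sub-functionals on the ray through a vertex**: for a `0/1`-valued supermultiplicative `β` on `Finset (Fin (n+1))`
(no top condition) and `v ∈ [0,1]`, `Φ_{n+1}(v·β) ≥ 0` (and the same along every embedding, by `…_map`). [this work] -/
theorem phiSet_smul_nonneg_of_zero_one (β : Finset (Fin (n + 1)) → ℝ) (h01 : ∀ B, β B = 0 ∨ β B = 1)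
    (hsup : ∀ S T, β S * β T ≤ β (S ∪ T)) {v : ℝ} (hv0 : 0 ≤ v) (hv1 : v ≤ 1) :
    0 ≤ phiSet (n + 1) (fun S => v * β S) :=
  phiSet_smul_nonneg_of_subfamilies β (phiSet_map_nonneg_of_zero_one β h01 hsup) hv0 hv1

/-- The union-closed-family form: `Φ_{n+1}(v·1_𝒰) ≥ 0` for every union-closed `𝒰` (univ ∈ 𝒰 NOT required) and `v ∈ [0,1]`.
[this work] -/
theorem phiSet_smul_indicator_nonneg (𝒰 : Finset (Finset (Fin (n + 1)))) (hU : ∀ A ∈ 𝒰, ∀ B ∈ 𝒰, A ∪ B ∈ 𝒰)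
    {v : ℝ} (hv0 : 0 ≤ v) (hv1 : v ≤ 1) :
    0 ≤ phiSet (n + 1) (fun S => v * (if S ∈ 𝒰 then 1 else 0)) := by
  refine phiSet_smul_nonneg_of_zero_one _ (fun B => ?_) (fun S T => ?_) hv0 hv1
  · by_cases h : B ∈ 𝒰
    · exact Or.inr (if_pos h)
    · exact Or.inl (if_neg h)
  · by_cases hS : S ∈ 𝒰
    · by_cases hT : T ∈ 𝒰
      · rw [if_pos hS, if_pos hT, if_pos (hU S hS T hT), mul_one]
      · rw [if_neg hT, mul_zero]; split_ifs <;> norm_num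
    · rw [if_neg hS, zero_mul]; split_ifs <;> norm_num

/-- **`F(n+1)` on the two-level chains through `i₀`.**  For a union-closed family `𝒰 ∋ univ`, an index `i₀` and `v ∈ [0,1]`, the
set function `β(S) = 1` if `S ∈ 𝒰, i₀ ∈ S`, `= v` if `S ∈ 𝒰, i₀ ∉ S`, `= 0` if `S ∉ 𝒰` — a feasible point of `PhiNonneg (n+1)`
(values in `[0,1]`, `β univ = 1`, supermultiplicative) that is not a vertex for `0 < v < 1` — has `Φ_{n+1}(β) ≥ 0`.
(`Φ_{n+1}(v·1_𝒰) = v·Φ_{n+1}(β)` by `phiSet_scale`.) [this work] -/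
theorem phiSet_chain_singleton_nonneg (𝒰 : Finset (Finset (Fin (n + 1)))) (hU : ∀ A ∈ 𝒰, ∀ B ∈ 𝒰, A ∪ B ∈ 𝒰)
    (htop : univ ∈ 𝒰) (i₀ : Fin (n + 1)) {v : ℝ} (hv0 : 0 ≤ v) (hv1 : v ≤ 1) :
    0 ≤ phiSet (n + 1) (fun S => if S ∈ 𝒰 then (if i₀ ∈ S then 1 else v) else 0) := by
  rcases eq_or_lt_of_le hv0 with hv | hv
  · -- `v = 0`: the point is the vertex `1_{𝒰 ∩ [∋ i₀]}`
    subst hv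
    refine PhiVertex.phiSet_nonneg_of_zero_one n _ (fun B => ?_) (by rw [if_pos htop, if_pos (mem_univ _)]) (fun S T => ?_)
    · by_cases h : B ∈ 𝒰
      · rw [if_pos h]
        by_cases hi : i₀ ∈ B
        · exact Or.inr (if_pos hi)
        · exact Or.inl (if_neg hi)
      · exact Or.inl (if_neg h)
    · by_cases hS : S ∈ 𝒰
      · by_cases hT : T ∈ 𝒰
        · rw [if_pos hS, if_pos hT, if_pos (hU S hS T hT)]
          by_cases hiS : i₀ ∈ S
          · rw [if_pos hiS, if_pos (mem_union_left T hiS), one_mul]; split_ifs <;> norm_num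
          · rw [if_neg hiS, zero_mul]; split_ifs <;> norm_num
        · rw [if_neg hT, mul_zero]; split_ifs <;> norm_num
      · rw [if_neg hS, zero_mul]; split_ifs <;> norm_num
  · -- `v > 0`: scale out `v` on the sets avoiding `i₀`
    have key := phiSet_smul_indicator_nonneg 𝒰 hU hv0 hv1
    have hm : ∀ B : Finset (Fin (n + 1)), v * (if B ∈ 𝒰 then (1 : ℝ) else 0) =
        (∏ i ∈ B, (if i = i₀ then v else (1 : ℝ))) * (if B ∈ 𝒰 then (if i₀ ∈ B then 1 else v) else 0) := by
      intro B
      have hPB : ∏ i ∈ B, (if i = i₀ then v else (1 : ℝ)) = if i₀ ∈ B then v else 1 := by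
        rw [prod_ite_eq']
      rw [hPB]
      by_cases hB : B ∈ 𝒰
      · rw [if_pos hB, if_pos hB]
        by_cases hi : i₀ ∈ B
        · rw [if_pos hi, if_pos hi, mul_one]
        · rw [if_neg hi, if_neg hi, mul_one, one_mul]
      · rw [if_neg hB, if_neg hB, mul_zero, mul_zero]
    have hscale := PrincipalCapBeta.phiSet_scale (n := n + 1) (fun S => v * (if S ∈ 𝒰 then (1 : ℝ) else 0))
      (fun S => if S ∈ 𝒰 then (if i₀ ∈ S then 1 else v) else 0) (fun i => if i = i₀ then v else 1) hm
    rw [hscale] at key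
    have hP : ∏ i : Fin (n + 1), (if i = i₀ then v else (1 : ℝ)) = v := by
      rw [prod_ite_eq']; simp
    rw [hP] at key
    exact (mul_nonneg_iff_of_pos_left hv).1 key

end PhiScale

end Summit.CriticalPhenomena.PercolationContinuityZ3.Theorems
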